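import Summits.BirchSwinnertonDyer.BirchSwinnertonDyer.Theorems.ThetaPartnerAtTwoSignedControlAtTwoH1SigmaLocalBounds
import Summits.BirchSwinnertonDyer.BirchSwinnertonDyer.Theorems.ThetaPartnerAtTwoSignedControlAtTwoRelaxedKummerCountLevelZero
import Summits.BirchSwinnertonDyer.Rank1Residual.X11b.KummerRelaxedStructures
import Literature.NumberTheory.EllipticCurves.GreenbergVatsal2000.GreenbergSelmerGroups
import Literature.NumberTheory.EllipticCurves.SelmerLevelToPrimary
import Literature.NumberTheory.EllipticCurves.SelmerDivisiblePartIsogenyProofs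
import Literature.NumberTheory.EllipticCurves.SubgroupSelmerProofs
import Literature.NumberTheory.EllipticCurves.SubgroupSelmerCocycleCriteriaProofs
import Literature.NumberTheory.EllipticCurves.KummerSelmerStructure
import HarnessLib

/-!
# Cassels' theorem from Poitou–Tate, the dictionary: from a global class `x ∈ H¹(K, E[p^M])` to the class
# `res_⊤ ι_* x ∈ H¹(⊤, E[p^∞])` of the Greenberg facts — its local restrictions, its unramifiedness — and the
# exponents of `Sel_{p^∞}(E/K)` relaxed at the infinite places

Crux K4 `SignedControlAtTwo` (stmt-BirchSwinnertonDyer-20309; routes `ThetaPartnerAtTwo` /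
`ResidualThetaTransportAtTwo`), line `eulerchar` v10, stub `stub_pubGreenbergPTTwo` = {Cassels, Prop. 4.12,
`poitouTate_selmerStructure_duality ℚ`}; width seat `prover-bsd-wall-tp2-p3-w3` g6 (Cassels lane). GLUE between the
currency of the Poitou–Tate files (`galoisCohomology (W.torsionGaloisModule n) 1`, `galoisCohomology.localization`,
`kummerSelmerStructure`) and the currency of `Greenberg1999.casselsSurjectivity_H1Sigma` (`W.subgroupH1 p ⊤`,
`localResOver`, `GreenbergVatsal2000.unramifiedOutside`, `discreteH1 (localSubgroup ⊤ K_v) (localPoints W K_v)`):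

* `localResOver_top_res_torsionPowToPrimaryH1` — for `x ∈ H¹(K, E[p^M])`, the local restriction at a `K`-field `E`
  of `res_⊤ ι_* x` is the restriction to `(Γ_E → Γ_K)⁻¹(⊤)` of `κ_E(res_E x) ∈ H¹(Γ_E, E(K̄_E))` (tree
  `localResOver_top_resH1Hom_subgroupIncl` + `map_res_torsionGaloisModule_apply`);
* `res_torsionPowToPrimaryH1_mem_unramifiedKer` — if `loc_v x ∈ H¹_ur(K_v, E[p^M])` then `res_⊤ ι_* x` lies in
  `GreenbergVatsal2000.unramifiedKer ⊤ E[p^∞] v` (the global inertia group `I_v` is the image of the local one);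
* `torsionPowToPrimaryH1_mem_iInf_selmerLocalKerPrimary` — Kummer at every finite place ⟹ `ι_* x` lies in the
  `p^∞`-Selmer group RELAXED AT THE INFINITE PLACES `⨅_v selmerLocalKerPrimary`;
* `finite_iInf_selmerLocalKerPrimary` — that relaxed Selmer group is FINITE when `Sel_{p^∞}(E/K)` is (its image in
  the finite `∏_{w∣∞} H¹(K_w, E)` has kernel `Sel_{p^∞}(E/K)`), and `exists_forall_pow_nsmul_eq_zero_of_finite` —
  a finite subgroup of `H¹(K, E[p^∞])` has a uniform exponent `p^e`;
* `exists_preimage_localSubgroup_top` — every class of `discreteH1 (localSubgroup ⊤ E) (localPoints W E)` is the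
  restriction of a class of `H¹(Γ_E, E(K̄_E))`, with the same `p`-power exponent.

THEOREMS ONLY (no definition, no named fact, no `sorry`); BSD is not proved by any of this.

References: [GreenbergLNM1716] §2 (pp. 62–63, 72), §4 Appendix p. 121–122; [GreenbergVatsal2000] §2 pp. 16–17;
[MilneADT2006] I §6 (6.14), Lemma 6.15.
-/

set_option autoImplicit false
-- the Theorems namespace of this sub repeats the summit name by design (D-0017 nested layout)
set_option linter.dupNamespace false

noncomputable section

open scoped Classical

open Field Function NumberField IsDedekindDomain WeierstrassCurve
open Literature.NumberTheory.EllipticCurves Literature.NumberTheory.GaloisRepresentations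
open Literature.NumberTheory.GaloisRepresentations.DiscreteGaloisModule (unramifiedSubgroup)
open Literature.NumberTheory.EllipticCurves.GreenbergSelmer
open scoped ContRepresentation

namespace Summit.BirchSwinnertonDyer.BirchSwinnertonDyer.Theorems.SignedEC.CasselsPT

open Summit.BirchSwinnertonDyer.Rank1Residual.X11b.LocBridge

variable {K : Type} [Field K] (W : WeierstrassCurve K) (p : ℕ)

/-! ## §1 Local restrictions of `res_⊤ ι_* x` -/

section LocalRes

variable (M : ℕ) (E : Type) [Field E] [Algebra K E]

/-- **The local restriction of `res_⊤ ι_* x` at a `K`-field `E`** (`x ∈ H¹(K, E[p^M])`, `ι : E[p^M] ↪ E[p^∞]`,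
`res_⊤ : H¹(Γ_K, ·) ⥲ H¹(⊤, ·)`): it is the restriction to the local subgroup `(Γ_E → Γ_K)⁻¹(⊤) ≤ Γ_E` of the class
`κ_E(res_E x) ∈ H¹(Γ_E, E(K̄_E))`, where `res_E` is the restriction to `Γ_E` (`galoisCohomology.res`, the
localisation when `E = K_v`) and `κ_E` the change of coefficients `E[p^M](K̄) → E(K̄_E)`
(`torsionPointsMapIntertwining`). All maps are maps of compatible pairs and compose
(`localResOver_top_resH1Hom_subgroupIncl`, `map_res_torsionGaloisModule_apply`, `resH1Hom_comp`).
[cite: GreenbergLNM1716, §2 (p. 72, the maps `H¹(M, E[p^∞]) → H¹(M_η, E)`)] -/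
theorem localResOver_top_res_torsionPowToPrimaryH1 (x : galH1Torsion W ((p ^ M : ℕ) : ℤ)) :
    W.localResOver p ⊤ E
        (resH1Hom (Literature.NumberTheory.EllipticCurves.subgroupIncl (⊤ : Subgroup (absoluteGaloisGroup K)))
          (AddMonoidHom.id (geomPrimaryTorsion W p)) (fun _ _ ↦ rfl) (torsionPowToPrimaryH1 W p M x)) =
      resH1Hom (Literature.NumberTheory.EllipticCurves.subgroupIncl
          (localSubgroup (⊤ : Subgroup (absoluteGaloisGroup K)) E))
        (AddMonoidHom.id (localPoints W E)) (fun _ _ ↦ rfl)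
        (galoisCohomology.map (W.torsionPointsMapIntertwining ((p ^ M : ℕ) : ℤ) E) 1
          (galoisCohomology.res (W.torsionGaloisModule ((p ^ M : ℕ) : ℤ)) E 1 x)) := by
  rw [W.localResOver_top_resH1Hom_subgroupIncl p]
  congr 1
  rw [W.map_res_torsionGaloisModule_apply ((p ^ M : ℕ) : ℤ) E x]
  unfold torsionPowToPrimaryH1
  rw [← AddMonoidHom.comp_apply, resH1Hom_comp]
  exact DFunLike.congr_fun (resH1Hom_congr (by ext; rfl) (by ext; rfl) _ _) x

end LocalRes

/-! ## §2 Unramified local classes give classes of `unramifiedKer` -/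

section Unramified

variable [NumberField K] (M : ℕ)

/-- **`loc_v x ∈ H¹_ur(K_v, E[p^M])` ⟹ `res_⊤ ι_* x ∈ unramifiedKer ⊤ E[p^∞] v`**: a cocycle `φ` of `x` restricted
to the local inertia group `I_{K_v}` is the coboundary of some `w ∈ E[p^M]` (tree
`LocBridge.mem_unramifiedSubgroup_one_iff_exists`); the Greenberg–Vatsal inertia group `I_v ≤ Γ_K` is the image of
`I_{K_v}` (`GreenbergSelmer.inertia`, by definition), so `ι ∘ φ` is the coboundary of `ι w` on `⊤ ⊓ I_v`
(`CocycleCriteria.resH1Hom_oneCocycleClass_eq_zero_iff`). [cite: GreenbergVatsal2000, §2 p. 17 («[σ|_{I_η}] = 0»)]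
[cite: MilneADT2006, Ch. I §2 (unramified cohomology)] -/
theorem res_torsionPowToPrimaryH1_mem_unramifiedKer {v : HeightOneSpectrum (𝓞 K)}
    (x : galH1Torsion W ((p ^ M : ℕ) : ℤ))
    (hx : galoisCohomology.localization (W.torsionGaloisModule ((p ^ M : ℕ) : ℤ)) (Sum.inr v) 1 x ∈
      unramifiedSubgroup (GaloisRep.toLocal v (W.torsionGaloisModule ((p ^ M : ℕ) : ℤ))) 1) :
    resH1Hom (Literature.NumberTheory.EllipticCurves.subgroupIncl (⊤ : Subgroup (absoluteGaloisGroup K)))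
        (AddMonoidHom.id (geomPrimaryTorsion W p)) (fun _ _ ↦ rfl) (torsionPowToPrimaryH1 W p M x) ∈
      GreenbergVatsal2000.unramifiedKer (⊤ : Subgroup (absoluteGaloisGroup K)) (W.geomPrimaryTorsion p) v := by
  obtain ⟨φ, rfl⟩ :=
    oneCocycleClass_surjective (discreteTopRep (absoluteGaloisGroup K) (geomTorsion W ((p ^ M : ℕ) : ℤ))) x
  -- unpack the unramified condition on the cocycle
  change galoisCohomology.res (W.torsionGaloisModule ((p ^ M : ℕ) : ℤ)) (v.adicCompletion K) 1
      (oneCocycleClass (discreteTopRep (absoluteGaloisGroup K) (geomTorsion W ((p ^ M : ℕ) : ℤ))) φ) ∈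
      unramifiedSubgroup (GaloisRep.restrictField (v.adicCompletion K)
        (W.torsionGaloisModule ((p ^ M : ℕ) : ℤ))) 1 at hx
  rw [W.res_torsionGaloisModule_oneCocycleClass] at hx
  obtain ⟨w, hw⟩ := (mem_unramifiedSubgroup_one_iff_exists _ _).mp hx
  -- the class in `H¹(⊤, E[p^∞])` and its restriction to `⊤ ⊓ I_v`
  unfold torsionPowToPrimaryH1
  rw [GreenbergVatsal2000.unramifiedKer, AddMonoidHom.mem_ker, resH1Hom_resH1Hom, resH1Hom_resH1Hom,
    CocycleCriteria.resH1Hom_oneCocycleClass_eq_zero_iff]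
  refine ⟨AddSubgroup.inclusion
    (Literature.Barriers.BirchSwinnertonDyer.geomTorsion_pow_le_geomPrimaryTorsion W p M) w, fun y ↦ ?_⟩
  -- `y ∈ I_v = res(I_{K_v})`
  have hyI : ((y : decomp (K := K) v) : absoluteGaloisGroup K) ∈ inertia v :=
    ((mem_inertiaIn_iff ⊤ v _).1 y.2).2
  obtain ⟨τ, hτ, hτy⟩ := Subgroup.mem_map.mp hyI
  have h := hw τ hτ
  rw [contOneCocycles.pullback_apply] at h
  change φ.1 (absGaloisRestrict K (v.adicCompletion K) τ) =
    absGaloisRestrict K (v.adicCompletion K) τ • w - w at h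
  have hτy' : absGaloisRestrict K (v.adicCompletion K) τ = ((y : decomp (K := K) v) : absoluteGaloisGroup K) :=
    hτy
  rw [hτy'] at h
  change AddSubgroup.inclusion
      (Literature.Barriers.BirchSwinnertonDyer.geomTorsion_pow_le_geomPrimaryTorsion W p M)
      (φ.1 ((y : decomp (K := K) v) : absoluteGaloisGroup K)) =
    ((y : decomp (K := K) v) : absoluteGaloisGroup K) •
        AddSubgroup.inclusion
          (Literature.Barriers.BirchSwinnertonDyer.geomTorsion_pow_le_geomPrimaryTorsion W p M) w -
      AddSubgroup.inclusion
          (Literature.Barriers.BirchSwinnertonDyer.geomTorsion_pow_le_geomPrimaryTorsion W p M) w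
  rw [h, map_sub]
  rfl

end Unramified

/-! ## §3 The relaxed `p^∞`-Selmer group `⨅_v Sel-local kernels` (finite places only) -/

section Relaxed

variable [NumberField K] [W.IsElliptic] [Fact p.Prime]

omit [W.IsElliptic] [Fact p.Prime] in
/-- **Kummer at every finite place ⟹ `ι_* x` is Selmer at every finite place**: for `x ∈ H¹(K, E[p^M])` with
`loc_v x ∈ 𝓛_v` at all finite `v`, `ι_* x ∈ ⨅_v selmerLocalKerPrimary W K_v p` (tree
`comap_localization_kummerSelmerStructure`: `res_v⁻¹ 𝓛_v` is the Selmer local kernel; tree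
`resH1Hom_inclusion_mem_selmerLocalKerPrimary`: Selmer conditions pass from `E[p^M]` to `E[p^∞]`).
[cite: GreenbergLNM1716, §2 (p. 63)] [cite: MilneADT2006, Ch. I §6 (6.14)] -/
theorem torsionPowToPrimaryH1_mem_iInf_selmerLocalKerPrimary (M : ℕ)
    (x : galH1Torsion W ((p ^ M : ℕ) : ℤ))
    (hx : ∀ v : HeightOneSpectrum (𝓞 K),
      galoisCohomology.localization (W.torsionGaloisModule ((p ^ M : ℕ) : ℤ)) (Sum.inr v) 1 x ∈
        W.kummerSelmerStructure ((p ^ M : ℕ) : ℤ) (Sum.inr v)) :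
    torsionPowToPrimaryH1 W p M x ∈
      ⨅ v : HeightOneSpectrum (𝓞 K), selmerLocalKerPrimary W (v.adicCompletion K) p := by
  rw [AddSubgroup.mem_iInf]
  intro v
  have hxv : x ∈ selmerLocalKer W (v.adicCompletion K) ((p ^ M : ℕ) : ℤ) :=
    (SetLike.ext_iff.mp (W.comap_localization_kummerSelmerStructure ((p ^ M : ℕ) : ℤ) (Sum.inr v)) x).mp
      (hx v)
  exact RelaxedKummerCount.resH1Hom_inclusion_mem_selmerLocalKerPrimary W p M (v.adicCompletion K) hxv

omit [Fact p.Prime] in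
/-- **The `p^∞`-Selmer group relaxed at the infinite places is finite when `Sel_{p^∞}(E/K)` is**: its image in the
finite group `∏_{w∣∞} H¹(K_w, E(K̄_w))` (tree `finite_localH1_infinitePlace`, Greenberg p. 106) has kernel
`Sel_{p^∞}(E/K)`. [cite: GreenbergLNM1716, §4 pp. 105–106] -/
theorem finite_iInf_selmerLocalKerPrimary [Finite (W.selmerGroupPInfty p)] :
    Finite (⨅ v : HeightOneSpectrum (𝓞 K), selmerLocalKerPrimary W (v.adicCompletion K) p :
      AddSubgroup (W.galH1Primary p)) := by
  set A : AddSubgroup (W.galH1Primary p) :=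
    ⨅ v : HeightOneSpectrum (𝓞 K), selmerLocalKerPrimary W (v.adicCompletion K) p with hA
  -- the map to the infinite places
  let f : W.galH1Primary p →+ Π w : InfinitePlace K, discreteH1 (absoluteGaloisGroup w.Completion)
      (localPoints W w.Completion) :=
    AddMonoidHom.pi fun w ↦ resH1Hom (resGal (K := K) w.Completion)
      ((pointsMap W w.Completion).comp (geomPrimaryTorsion W p).subtype) (W.pointsMap_comp_subtype_smul p)
  let fA : A →+ Π w : InfinitePlace K, discreteH1 (absoluteGaloisGroup w.Completion)
      (localPoints W w.Completion) := f.comp A.subtype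
  haveI : ∀ w : InfinitePlace K, Finite (discreteH1 (absoluteGaloisGroup w.Completion)
      (localPoints W w.Completion)) := fun w ↦ H1SigmaCorank.finite_localH1_infinitePlace W w
  haveI : Finite fA.range := inferInstance
  haveI : Finite fA.ker := by
    refine Finite.of_injective (fun a : fA.ker ↦ (⟨((a : A) : W.galH1Primary p), ?_⟩ : W.selmerGroupPInfty p))
      fun a b h ↦ Subtype.ext (Subtype.ext (by simpa using congrArg Subtype.val h))
    have ha : fA (a : A) = 0 := (AddMonoidHom.mem_ker).mp a.2
    rw [selmerGroupPInfty, AddSubgroup.mem_inf, AddSubgroup.mem_iInf, AddSubgroup.mem_iInf]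
    refine ⟨fun v ↦ (AddSubgroup.mem_iInf.mp (a : A).2) v, fun w ↦ ?_⟩
    rw [W.mem_selmerLocalKerPrimary_iff p]
    exact congrFun ha w
  exact (AddMonoidHom.finite_iff_finite_ker_range fA).mpr ⟨inferInstance, inferInstance⟩

omit [W.IsElliptic] [Fact p.Prime] in
/-- **A finite subgroup of `H¹(K, E[p^∞])` has a uniform exponent `p^e`** (every class is `p`-power torsion,
tree `exists_pow_nsmul_eq_zero_of_mem`). [cite: GreenbergLNM1716, §2 (p. 62)] -/
theorem exists_forall_pow_nsmul_eq_zero_of_finite (A : AddSubgroup (W.galH1Primary p)) [Finite A] :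
    ∃ e : ℕ, ∀ a ∈ A, p ^ e • a = 0 := by
  haveI := Fintype.ofFinite A
  choose f hf using fun a : A ↦ exists_pow_nsmul_eq_zero_of_mem W p A a
  refine ⟨Finset.univ.sup f, fun a ha ↦ ?_⟩
  obtain ⟨k, hk⟩ := Nat.exists_eq_add_of_le' (Finset.le_sup (f := f) (Finset.mem_univ ⟨a, ha⟩))
  have h : p ^ Finset.univ.sup f • (⟨a, ha⟩ : A) = 0 := by
    rw [hk, pow_add, mul_smul, hf ⟨a, ha⟩, smul_zero]
  exact congrArg Subtype.val h

end Relaxed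

/-! ## §4 The currency of the Greenberg facts at one place -/

section Currency

variable (E : Type) [Field E] [Algebra K E]

/-- **Every class of `discreteH1 (localSubgroup ⊤ E) (localPoints W E)` is the restriction of a unique class of
`H¹(Γ_E, E(K̄_E))`, with the same exponent** (the restriction along `(Γ_E → Γ_K)⁻¹(⊤) ↪ Γ_E` is bijective, tree
`bijective_resH1Hom_subgroupIncl`). [cite: GreenbergLNM1716, §2 (the groups `G_{M_η}`)] -/
theorem exists_preimage_localSubgroup_top (k : ℕ)
    (x : discreteH1 (localSubgroup (⊤ : Subgroup (absoluteGaloisGroup K)) E) (localPoints W E))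
    (hx : p ^ k • x = 0) :
    ∃ a : discreteH1 (absoluteGaloisGroup E) (localPoints W E),
      resH1Hom (Literature.NumberTheory.EllipticCurves.subgroupIncl
          (localSubgroup (⊤ : Subgroup (absoluteGaloisGroup K)) E))
        (AddMonoidHom.id (localPoints W E)) (fun _ _ ↦ rfl) a = x ∧ p ^ k • a = 0 := by
  have hbij := bijective_resH1Hom_subgroupIncl (localPoints W E)
    (localSubgroup (⊤ : Subgroup (absoluteGaloisGroup K)) E) mem_localSubgroup_top
  obtain ⟨a, ha⟩ := hbij.2 x
  refine ⟨a, ha, hbij.1 ?_⟩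
  rw [map_nsmul, map_zero, ha, hx]

end Currency

end Summit.BirchSwinnertonDyer.BirchSwinnertonDyer.Theorems.SignedEC.CasselsPT

end
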